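import Summits.ValiantsHypothesis.ValiantsHypothesis.Theorems.LacunarySymmetroidMatrixDescartesCensusDoorA34NullNullEndTests

/-!
# `MatrixDescartes` census — DOOR A at `(3,4)`: HIDDEN TYPES of the middle letters on the null-null sheet, read from either semidefinite singular end, and the
# type tests DI / DD at both ends (hypothetical null-null seventeens; decidable in `d`, orientation on `c_{001}`)

HONEST FRAMING.  Object-search cell `pub-symmetroid`, engine seat `val-sym-eng-2` (g5); helper rows beside the registered strata line
`Cruxes/DoorA34/Lines/strata.lean` on stmt-ValiantsHypothesis-19980 (`DoorA34 = PosRootLawAt 3 4 18`: OPEN, typed, never asserted here); third stub `stub_nullNullCeiling`.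
The null-top machinery of …SheetHiddenDefinite transported to the null-null sheet: with `S₃ ⪰ 0` (top end) or `S₀ ⪰ 0` (bottom end) the three slot signs
`(c_{Exx}, c_{xxx}, c_{EEx})` pin the inertia type of each middle letter `x ∈ {1,2}`; the definite-letter tests of …NullNullSheetDefiniteLetter
(`definite_pair_count_nullNull`, `definite_indefinite_count_nullNull`) then run with the definiteness DISCHARGED:
`hiddenType_top/bottom_of_nullNull_seventeen`, `hiddenDefinite_top/bottom_of_parity_nullNull`, `top/bottom_square_pos_of_orientation_nullNull`,
**`card_posRoots_le_16_of_nullNull_topTypeTestDI/DD`**, **`card_posRoots_le_16_of_nullNull_bottomTypeTestDI/DD`** (mirror cells `⪯ 0` follow by `S ↦ −S` with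
`posRoots_pencil_neg_three`, as in …NullNullEndTests; not restated here).  In the seat's atlas these tests (law families L3/L4) account for the kills not already
done by end-cell pinning and the end pair laws.  Nothing here bounds anything else; `DoorA34` and the three stubs stay OPEN; registers unchanged; nothing on
`MatrixDescartes` (stmt-ValiantsHypothesis-18050) or `VP ≠ VNP` — VP≠VNP not moved.  [folklore] Descartes bookkeeping; elementary.
-/

-- `Summit.ValiantsHypothesis.ValiantsHypothesis.…` repeats a component by the D-0017 layout
-- (single-conjunct summit), which the `dupNamespace` linter flags; the name is mandated.
set_option linter.dupNamespace false

namespace Summit.ValiantsHypothesis.ValiantsHypothesis.Theorems.LacunarySymmetroidMatrixDescartes.Census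

open Polynomial Finset Matrix
open scoped BigOperators Polynomial Matrix

/-! ## Hidden types of the middle letters read from the top end (`S_3 ⪰ 0`) -/

/-- **HIDDEN TYPE OF A MIDDLE LETTER from the top end (`S_3 ⪰ 0`)** on a null-null seventeen: for `x ∈ {1,2}` with `q = c_{3xx} = tr(adj S_x·S_3)`,
`T = c_{33x} = tr(adj S_3·S_x)`, `δ = det S_x`: `q > 0 ∧ δ > 0 ∧ T > 0 ⇒ S_x ≻ 0`; `q > 0 ∧ δ < 0 ∧ T < 0 ⇒ S_x ≺ 0`; `q < 0` or `δ·T < 0` ⇒ not definite. [folklore] -/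
theorem hiddenType_top_of_nullNull_seventeen (d : Fin 4 → ℕ) (hd : StrictMono d) (S : Fin 4 → Matrix (Fin 3) (Fin 3) ℝ)
    (hS : ∀ l, (S l).IsSymm) (h0 : (S 0).det = 0) (h3 : (S 3).det = 0) (hpsd : (S 3).PosSemidef) (h17 : 17 ≤ ((Matrix.det (∑ l, ((X : ℝ[X]) ^ d l) • (S l).map C)).roots.toFinset.filter (fun t => 0 < t)).card) {x : Fin 4} (hx : x ≠ 3) :
    (0 < ((S x).adjugate * S 3).trace → 0 < (S x).det → 0 < ((S 3).adjugate * S x).trace → (S x).PosDef)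
    ∧ (0 < ((S x).adjugate * S 3).trace → (S x).det < 0 → ((S 3).adjugate * S x).trace < 0 → (-S x).PosDef)
    ∧ (((S x).adjugate * S 3).trace < 0 → ¬ (S x).PosDef ∧ ¬ (-S x).PosDef)
    ∧ ((S x).det * ((S 3).adjugate * S x).trace < 0 → ¬ (S x).PosDef ∧ ¬ (-S x).PosDef) := by
  obtain ⟨k, hk, hPk⟩ := Matrix.exists_mulVec_eq_zero_iff.mpr h3
  have rel := top_slot_mul_dotProduct_mulVec_pos_of_nullNull_seventeen d hd S hS h0 h3 hpsd h17 hk hPk hx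
  refine ⟨fun hq hdet hT => ?_, fun hq hdet hT => ?_, fun hq => not_definite_of_trace_adjugate_mul_neg hpsd hq, fun hprod => ?_⟩
  · exact posDef_of_sheet_signs hpsd hPk (hS x) hq hdet (by nlinarith [rel, hT])
  · exact neg_posDef_of_sheet_signs hpsd hPk (hS x) hq hdet (by nlinarith [rel, hT])
  · refine not_definite_of_dotProduct_mulVec_mul_det_neg hk ?_
    have e : ((S 3).adjugate * S x).trace * (k ⬝ᵥ S x *ᵥ k) * ((S x).det * ((S 3).adjugate * S x).trace)
        = ((S 3).adjugate * S x).trace ^ 2 * ((k ⬝ᵥ S x *ᵥ k) * (S x).det) := by ring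
    have hneg : ((S 3).adjugate * S x).trace * (k ⬝ᵥ S x *ᵥ k) * ((S x).det * ((S 3).adjugate * S x).trace) < 0 :=
      mul_neg_of_pos_of_neg rel hprod
    rw [e] at hneg
    exact neg_of_mul_neg_right hneg (sq_nonneg _)

/-- From the top end: `c_{3xx} > 0` (read off the orientation `0 < (−1)^{ρ(2d_x+d_3)}·c_{001}`) and `ρ(3d_x) ≡ ρ(2d_3+d_x)` make the middle letter `x` DEFINITE,
positive iff `c_{33x} > 0`. [folklore] -/
theorem hiddenDefinite_top_of_parity_nullNull (d : Fin 4 → ℕ) (hd : StrictMono d) (S : Fin 4 → Matrix (Fin 3) (Fin 3) ℝ)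
    (hS : ∀ l, (S l).IsSymm) (h0 : (S 0).det = 0) (h3 : (S 3).det = 0) (hpsd : (S 3).PosSemidef) (h17 : 17 ≤ ((Matrix.det (∑ l, ((X : ℝ[X]) ^ d l) • (S l).map C)).roots.toFinset.filter (fun t => 0 < t)).card)
    {x : Fin 4} (hx0 : x ≠ 0) (hx3 : x ≠ 3)
    (ρ : ℕ → ℕ) (hρ' : ∀ n, ρ n = ((Matrix.det (∑ l, ((X : ℝ[X]) ^ d l) • (S l).map C)).support.filter (· < n)).card)
    (hqx : 0 < ((S x).adjugate * S 3).trace) (hxdef : (ρ (3 * d x) + ρ (2 * d 3 + d x)) % 2 = 0) :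
    ((S x).PosDef ∨ (-S x).PosDef) ∧ ((S x).PosDef ↔ 0 < ((S 3).adjugate * S x).trace) := by
  obtain ⟨HP, HN, -, -⟩ := hiddenType_top_of_nullNull_seventeen d hd S hS h0 h3 hpsd h17 hx3
  obtain ⟨cTx, mTx⟩ := coeff_square_of_nullNull_seventeen d hd S h0 h3 h17 3 x hx3.symm
  obtain ⟨cx3, mx3⟩ := coeff_cube_of_nullNull_seventeen d hd S h0 h3 h17 x hx0 hx3
  have rx := (coeff_mul_coeff_sign_of_nullNull_seventeen d S h0 h3 h17 mx3 mTx).1 (by rw [← hρ', ← hρ']; exact hxdef)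
  rw [cx3, cTx] at rx
  have hdx := det_letter_ne_zero_of_nullNull_seventeen d hd S h0 h3 h17 x hx0 hx3
  obtain ⟨k, hk, hPk⟩ := Matrix.exists_mulVec_eq_zero_iff.mpr h3
  have relx := top_slot_mul_dotProduct_mulVec_pos_of_nullNull_seventeen d hd S hS h0 h3 hpsd h17 hk hPk hx3
  rcases lt_or_gt_of_ne hdx with hneg | hpos
  · have hT : ((S 3).adjugate * S x).trace < 0 := by nlinarith [rx, hneg]
    have hN := HN hqx hneg hT
    refine ⟨Or.inr hN, iff_of_false (fun hP' => ?_) (not_lt.mpr hT.le)⟩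
    have h1 : 0 < k ⬝ᵥ S x *ᵥ k := by simpa using hP'.dotProduct_mulVec_pos hk
    nlinarith [relx, h1, hT]
  · have hT : 0 < ((S 3).adjugate * S x).trace := by nlinarith [rx, hpos]
    exact ⟨Or.inl (HP hqx hpos hT), iff_of_true (HP hqx hpos hT) hT⟩

/-- The orientation read on a square slot `c_{3xx}` of the top end: `0 < (−1)^{ρ(2d_x+d_3)}·c_{001} ⇒ c_{3xx} > 0`. [folklore] -/
theorem top_square_pos_of_orientation_nullNull (d : Fin 4 → ℕ) (hd : StrictMono d) (S : Fin 4 → Matrix (Fin 3) (Fin 3) ℝ) (h0 : (S 0).det = 0)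
    (h3 : (S 3).det = 0) (h17 : 17 ≤ ((Matrix.det (∑ l, ((X : ℝ[X]) ^ d l) • (S l).map C)).roots.toFinset.filter (fun t => 0 < t)).card) {x : Fin 4} (hx3 : x ≠ 3)
    (ρ : ℕ → ℕ) (hρ' : ∀ n, ρ n = ((Matrix.det (∑ l, ((X : ℝ[X]) ^ d l) • (S l).map C)).support.filter (· < n)).card)
    (hor : 0 < (-1 : ℝ) ^ ρ (2 * d x + d 3) * ((S 0).adjugate * S 1).trace) : 0 < ((S x).adjugate * S 3).trace := by
  obtain ⟨cxx, mxx⟩ := coeff_square_of_nullNull_seventeen d hd S h0 h3 h17 x 3 hx3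
  obtain ⟨c01, m01⟩ := coeff_square_of_nullNull_seventeen d hd S h0 h3 h17 0 1 (by decide)
  have hrank0 := rank_subbottom_of_nullNull_seventeen d hd S h0 h3 h17
  have r0 := coeff_mul_coeff_sign_of_nullNull_seventeen d S h0 h3 h17 m01 mxx
  rw [c01, cxx, hrank0, zero_add, ← hρ'] at r0
  rcases Nat.mod_two_eq_zero_or_one (ρ (2 * d x + d 3)) with p | p
  · have := r0.1 p
    rw [neg_one_pow_eq_pow_mod_two, p, pow_zero, one_mul] at hor
    nlinarith [this, hor]
  · have := r0.2 p
    rw [neg_one_pow_eq_pow_mod_two, p, pow_one, neg_one_mul, neg_pos] at hor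
    nlinarith [this, hor]

/-- **TYPE TEST DI from the top end (`S_3 ⪰ 0`) on the null-null sheet**: middle letters `x ≠ y` (`x, y ∈ {1,2}`), `x` hidden-definite, `y` hidden-indefinite
(`c_{3yy} < 0`: parity differs, or `c_{yyy}c_{33y} < 0`), edge count `V_xy ∈ {0,3}`; orientation `0 < (−1)^{ρ(2d_x+d_3)}·c_{001}` ⇒ `Z₊ ≤ 16`. [folklore] -/
theorem card_posRoots_le_16_of_nullNull_topTypeTestDI (d : Fin 4 → ℕ) (hd : StrictMono d) (S : Fin 4 → Matrix (Fin 3) (Fin 3) ℝ)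
    (hS : ∀ l, (S l).IsSymm) (h0 : (S 0).det = 0) (h3 : (S 3).det = 0) (hpsd : (S 3).PosSemidef)
    (ρ : ℕ → ℕ) (hρ : ∀ n, ρ n = ((((((Finset.univ : Finset (Sym (Fin 4) 3)).erase (Sym.replicate 3 3)).erase (Sym.replicate 3 0)).image
          (fun s : Sym (Fin 4) 3 => ((s : Multiset (Fin 4)).map d).sum)).filter (· < n)).card))
    {x y : Fin 4} (hxy : x ≠ y) (hx0 : x ≠ 0) (hx3 : x ≠ 3) (hy0 : y ≠ 0) (hy3 : y ≠ 3)
    (hor : 0 < (-1 : ℝ) ^ ρ (2 * d x + d 3) * ((S 0).adjugate * S 1).trace)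
    (hxdef : (ρ (3 * d x) + ρ (2 * d 3 + d x)) % 2 = 0)
    (hyind : ρ (2 * d y + d 3) % 2 ≠ ρ (2 * d x + d 3) % 2 ∨ (ρ (3 * d y) + ρ (2 * d 3 + d y)) % 2 = 1)
    (hV : (ρ (3 * d x) + ρ (2 * d x + d y)) % 2 + (ρ (2 * d x + d y) + ρ (2 * d y + d x)) % 2 + (ρ (2 * d y + d x) + ρ (3 * d y)) % 2 = 0
      ∨ (ρ (3 * d x) + ρ (2 * d x + d y)) % 2 + (ρ (2 * d x + d y) + ρ (2 * d y + d x)) % 2 + (ρ (2 * d y + d x) + ρ (3 * d y)) % 2 = 3) :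
    ((Matrix.det (∑ l, ((X : ℝ[X]) ^ d l) • (S l).map C)).roots.toFinset.filter (fun t => 0 < t)).card ≤ 16 := by
  by_contra hlt
  have h17 : 17 ≤ ((Matrix.det (∑ l, ((X : ℝ[X]) ^ d l) • (S l).map C)).roots.toFinset.filter (fun t => 0 < t)).card := by omega
  have hρ' : ∀ n, ρ n = ((Matrix.det (∑ l, ((X : ℝ[X]) ^ d l) • (S l).map C)).support.filter (· < n)).card := fun n => by rw [hρ, sheetRank_eq_of_nullNull_seventeen d S h0 h3 h17]
  have hqx := top_square_pos_of_orientation_nullNull d hd S h0 h3 h17 hx3 ρ hρ' hor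
  obtain ⟨hxd, -⟩ := hiddenDefinite_top_of_parity_nullNull d hd S hS h0 h3 hpsd h17 hx0 hx3 ρ hρ' hqx hxdef
  obtain ⟨-, -, HI1y, HI2y⟩ := hiddenType_top_of_nullNull_seventeen d hd S hS h0 h3 hpsd h17 hy3
  obtain ⟨cxx, mxx⟩ := coeff_square_of_nullNull_seventeen d hd S h0 h3 h17 x 3 hx3
  obtain ⟨cyy, myy⟩ := coeff_square_of_nullNull_seventeen d hd S h0 h3 h17 y 3 hy3
  obtain ⟨cTy, mTy⟩ := coeff_square_of_nullNull_seventeen d hd S h0 h3 h17 3 y hy3.symm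
  obtain ⟨cy3, my3⟩ := coeff_cube_of_nullNull_seventeen d hd S h0 h3 h17 y hy0 hy3
  have hyn : ¬ (S y).PosDef ∧ ¬ (-S y).PosDef := by
    rcases hyind with hpar | hpar
    · have rxy := (coeff_mul_coeff_sign_of_nullNull_seventeen d S h0 h3 h17 mxx myy).2 (by rw [← hρ', ← hρ']; omega)
      rw [cxx, cyy] at rxy
      exact HI1y (by nlinarith [rxy, hqx])
    · have ry := (coeff_mul_coeff_sign_of_nullNull_seventeen d S h0 h3 h17 my3 mTy).2 (by rw [← hρ', ← hρ']; exact hpar)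
      rw [cy3, cTy] at ry
      exact HI2y ry
  obtain ⟨v1, v2⟩ := definite_indefinite_count_nullNull d hd S hS h0 h3 hxy hx0 hx3 hy0 hy3 hxd hyn.1 hyn.2 h17 ρ hρ'
  rcases hV with hV | hV
  · exact v1 hV
  · exact v2 hV

/-- **TYPE TEST DD from the top end (`S_3 ⪰ 0`)**: two hidden-definite middle letters with the wrong edge count. [folklore] -/
theorem card_posRoots_le_16_of_nullNull_topTypeTestDD (d : Fin 4 → ℕ) (hd : StrictMono d) (S : Fin 4 → Matrix (Fin 3) (Fin 3) ℝ)
    (hS : ∀ l, (S l).IsSymm) (h0 : (S 0).det = 0) (h3 : (S 3).det = 0) (hpsd : (S 3).PosSemidef)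
    (ρ : ℕ → ℕ) (hρ : ∀ n, ρ n = ((((((Finset.univ : Finset (Sym (Fin 4) 3)).erase (Sym.replicate 3 3)).erase (Sym.replicate 3 0)).image
          (fun s : Sym (Fin 4) 3 => ((s : Multiset (Fin 4)).map d).sum)).filter (· < n)).card))
    {x y : Fin 4} (hxy : x ≠ y) (hx0 : x ≠ 0) (hx3 : x ≠ 3) (hy0 : y ≠ 0) (hy3 : y ≠ 3)
    (hor : 0 < (-1 : ℝ) ^ ρ (2 * d x + d 3) * ((S 0).adjugate * S 1).trace)
    (hxdef : (ρ (3 * d x) + ρ (2 * d 3 + d x)) % 2 = 0)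
    (hysq : ρ (2 * d y + d 3) % 2 = ρ (2 * d x + d 3) % 2) (hydef : (ρ (3 * d y) + ρ (2 * d 3 + d y)) % 2 = 0)
    (hV : ((ρ (2 * d 3 + d x) + ρ (2 * d 3 + d y)) % 2 = 0 ∧
        (ρ (3 * d x) + ρ (2 * d x + d y)) % 2 + (ρ (2 * d x + d y) + ρ (2 * d y + d x)) % 2 + (ρ (2 * d y + d x) + ρ (3 * d y)) % 2 ≠ 0)
      ∨ ((ρ (2 * d 3 + d x) + ρ (2 * d 3 + d y)) % 2 = 1 ∧
        (ρ (3 * d x) + ρ (2 * d x + d y)) % 2 + (ρ (2 * d x + d y) + ρ (2 * d y + d x)) % 2 + (ρ (2 * d y + d x) + ρ (3 * d y)) % 2 ≠ 3)) :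
    ((Matrix.det (∑ l, ((X : ℝ[X]) ^ d l) • (S l).map C)).roots.toFinset.filter (fun t => 0 < t)).card ≤ 16 := by
  by_contra hlt
  have h17 : 17 ≤ ((Matrix.det (∑ l, ((X : ℝ[X]) ^ d l) • (S l).map C)).roots.toFinset.filter (fun t => 0 < t)).card := by omega
  have hρ' : ∀ n, ρ n = ((Matrix.det (∑ l, ((X : ℝ[X]) ^ d l) • (S l).map C)).support.filter (· < n)).card := fun n => by rw [hρ, sheetRank_eq_of_nullNull_seventeen d S h0 h3 h17]
  have hqx := top_square_pos_of_orientation_nullNull d hd S h0 h3 h17 hx3 ρ hρ' hor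
  obtain ⟨cxx, mxx⟩ := coeff_square_of_nullNull_seventeen d hd S h0 h3 h17 x 3 hx3
  obtain ⟨cyy, myy⟩ := coeff_square_of_nullNull_seventeen d hd S h0 h3 h17 y 3 hy3
  obtain ⟨cTx, mTx⟩ := coeff_square_of_nullNull_seventeen d hd S h0 h3 h17 3 x hx3.symm
  obtain ⟨cTy, mTy⟩ := coeff_square_of_nullNull_seventeen d hd S h0 h3 h17 3 y hy3.symm
  have rxy := (coeff_mul_coeff_sign_of_nullNull_seventeen d S h0 h3 h17 mxx myy).1 (by rw [← hρ', ← hρ']; omega)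
  rw [cxx, cyy] at rxy
  have hqy : 0 < ((S y).adjugate * S 3).trace := by nlinarith [rxy, hqx]
  obtain ⟨hxd, hxiff⟩ := hiddenDefinite_top_of_parity_nullNull d hd S hS h0 h3 hpsd h17 hx0 hx3 ρ hρ' hqx hxdef
  obtain ⟨hyd, hyiff⟩ := hiddenDefinite_top_of_parity_nullNull d hd S hS h0 h3 hpsd h17 hy0 hy3 ρ hρ' hqy hydef
  obtain ⟨w0, w3⟩ := definite_pair_count_nullNull d hd S h0 h3 hxy hx0 hx3 hy0 hy3 hxd hyd h17 ρ hρ'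
  have rT := coeff_mul_coeff_sign_of_nullNull_seventeen d S h0 h3 h17 mTx mTy
  rw [cTx, cTy, ← hρ', ← hρ'] at rT
  have hTx := trace_adjugate_mul_ne_zero_of_nullNull_seventeen d hd S h0 h3 h17 3 x hx3.symm
  rcases hV with ⟨hpar, hV⟩ | ⟨hpar, hV⟩
  · have hTT := rT.1 hpar
    refine hV (w0 ?_)
    rw [hxiff, hyiff]
    rcases lt_or_gt_of_ne hTx with hn | hp
    · exact iff_of_false (not_lt.mpr hn.le) (fun h => by nlinarith [hTT, hn, h])
    · exact iff_of_true hp (by nlinarith [hTT, hp])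
  · have hTT := rT.2 hpar
    refine hV (w3 fun hiff => ?_)
    rw [hxiff, hyiff] at hiff
    rcases lt_or_gt_of_ne hTx with hn | hp
    · have hy' : ¬ 0 < ((S 3).adjugate * S y).trace := fun h => absurd (hiff.mpr h) (not_lt.mpr hn.le)
      nlinarith [hTT, hn, not_lt.mp hy']
    · nlinarith [hTT, hp, hiff.mp hp]

/-! ## Hidden types of the middle letters read from the bottom end (`S_0 ⪰ 0`) -/

/-- **HIDDEN TYPE OF A MIDDLE LETTER from the bottom end (`S_0 ⪰ 0`)** on a null-null seventeen: for `x ∈ {1,2}` with `q = c_{0xx} = tr(adj S_x·S_0)`,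
`T = c_{00x} = tr(adj S_0·S_x)`, `δ = det S_x`: `q > 0 ∧ δ > 0 ∧ T > 0 ⇒ S_x ≻ 0`; `q > 0 ∧ δ < 0 ∧ T < 0 ⇒ S_x ≺ 0`; `q < 0` or `δ·T < 0` ⇒ not definite. [folklore] -/
theorem hiddenType_bottom_of_nullNull_seventeen (d : Fin 4 → ℕ) (hd : StrictMono d) (S : Fin 4 → Matrix (Fin 3) (Fin 3) ℝ)
    (hS : ∀ l, (S l).IsSymm) (h0 : (S 0).det = 0) (h3 : (S 3).det = 0) (hpsd : (S 0).PosSemidef) (h17 : 17 ≤ ((Matrix.det (∑ l, ((X : ℝ[X]) ^ d l) • (S l).map C)).roots.toFinset.filter (fun t => 0 < t)).card) {x : Fin 4} (hx : x ≠ 0) :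
    (0 < ((S x).adjugate * S 0).trace → 0 < (S x).det → 0 < ((S 0).adjugate * S x).trace → (S x).PosDef)
    ∧ (0 < ((S x).adjugate * S 0).trace → (S x).det < 0 → ((S 0).adjugate * S x).trace < 0 → (-S x).PosDef)
    ∧ (((S x).adjugate * S 0).trace < 0 → ¬ (S x).PosDef ∧ ¬ (-S x).PosDef)
    ∧ ((S x).det * ((S 0).adjugate * S x).trace < 0 → ¬ (S x).PosDef ∧ ¬ (-S x).PosDef) := by
  obtain ⟨k, hk, hPk⟩ := Matrix.exists_mulVec_eq_zero_iff.mpr h0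
  have rel := bottom_slot_mul_dotProduct_mulVec_pos_of_nullNull_seventeen d hd S hS h0 h3 hpsd h17 hk hPk hx
  refine ⟨fun hq hdet hT => ?_, fun hq hdet hT => ?_, fun hq => not_definite_of_trace_adjugate_mul_neg hpsd hq, fun hprod => ?_⟩
  · exact posDef_of_sheet_signs hpsd hPk (hS x) hq hdet (by nlinarith [rel, hT])
  · exact neg_posDef_of_sheet_signs hpsd hPk (hS x) hq hdet (by nlinarith [rel, hT])
  · refine not_definite_of_dotProduct_mulVec_mul_det_neg hk ?_
    have e : ((S 0).adjugate * S x).trace * (k ⬝ᵥ S x *ᵥ k) * ((S x).det * ((S 0).adjugate * S x).trace)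
        = ((S 0).adjugate * S x).trace ^ 2 * ((k ⬝ᵥ S x *ᵥ k) * (S x).det) := by ring
    have hneg : ((S 0).adjugate * S x).trace * (k ⬝ᵥ S x *ᵥ k) * ((S x).det * ((S 0).adjugate * S x).trace) < 0 :=
      mul_neg_of_pos_of_neg rel hprod
    rw [e] at hneg
    exact neg_of_mul_neg_right hneg (sq_nonneg _)

/-- From the bottom end: `c_{0xx} > 0` (read off the orientation `0 < (−1)^{ρ(2d_x+d_0)}·c_{001}`) and `ρ(3d_x) ≡ ρ(2d_0+d_x)` make the middle letter `x` DEFINITE,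
positive iff `c_{00x} > 0`. [folklore] -/
theorem hiddenDefinite_bottom_of_parity_nullNull (d : Fin 4 → ℕ) (hd : StrictMono d) (S : Fin 4 → Matrix (Fin 3) (Fin 3) ℝ)
    (hS : ∀ l, (S l).IsSymm) (h0 : (S 0).det = 0) (h3 : (S 3).det = 0) (hpsd : (S 0).PosSemidef) (h17 : 17 ≤ ((Matrix.det (∑ l, ((X : ℝ[X]) ^ d l) • (S l).map C)).roots.toFinset.filter (fun t => 0 < t)).card)
    {x : Fin 4} (hx0 : x ≠ 0) (hx3 : x ≠ 3)
    (ρ : ℕ → ℕ) (hρ' : ∀ n, ρ n = ((Matrix.det (∑ l, ((X : ℝ[X]) ^ d l) • (S l).map C)).support.filter (· < n)).card)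
    (hqx : 0 < ((S x).adjugate * S 0).trace) (hxdef : (ρ (3 * d x) + ρ (2 * d 0 + d x)) % 2 = 0) :
    ((S x).PosDef ∨ (-S x).PosDef) ∧ ((S x).PosDef ↔ 0 < ((S 0).adjugate * S x).trace) := by
  obtain ⟨HP, HN, -, -⟩ := hiddenType_bottom_of_nullNull_seventeen d hd S hS h0 h3 hpsd h17 hx0
  obtain ⟨cTx, mTx⟩ := coeff_square_of_nullNull_seventeen d hd S h0 h3 h17 0 x hx0.symm
  obtain ⟨cx3, mx3⟩ := coeff_cube_of_nullNull_seventeen d hd S h0 h3 h17 x hx0 hx3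
  have rx := (coeff_mul_coeff_sign_of_nullNull_seventeen d S h0 h3 h17 mx3 mTx).1 (by rw [← hρ', ← hρ']; exact hxdef)
  rw [cx3, cTx] at rx
  have hdx := det_letter_ne_zero_of_nullNull_seventeen d hd S h0 h3 h17 x hx0 hx3
  obtain ⟨k, hk, hPk⟩ := Matrix.exists_mulVec_eq_zero_iff.mpr h0
  have relx := bottom_slot_mul_dotProduct_mulVec_pos_of_nullNull_seventeen d hd S hS h0 h3 hpsd h17 hk hPk hx0
  rcases lt_or_gt_of_ne hdx with hneg | hpos
  · have hT : ((S 0).adjugate * S x).trace < 0 := by nlinarith [rx, hneg]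
    have hN := HN hqx hneg hT
    refine ⟨Or.inr hN, iff_of_false (fun hP' => ?_) (not_lt.mpr hT.le)⟩
    have h1 : 0 < k ⬝ᵥ S x *ᵥ k := by simpa using hP'.dotProduct_mulVec_pos hk
    nlinarith [relx, h1, hT]
  · have hT : 0 < ((S 0).adjugate * S x).trace := by nlinarith [rx, hpos]
    exact ⟨Or.inl (HP hqx hpos hT), iff_of_true (HP hqx hpos hT) hT⟩

/-- The orientation read on a square slot `c_{0xx}` of the bottom end: `0 < (−1)^{ρ(2d_x+d_0)}·c_{001} ⇒ c_{0xx} > 0`. [folklore] -/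
theorem bottom_square_pos_of_orientation_nullNull (d : Fin 4 → ℕ) (hd : StrictMono d) (S : Fin 4 → Matrix (Fin 3) (Fin 3) ℝ) (h0 : (S 0).det = 0)
    (h3 : (S 3).det = 0) (h17 : 17 ≤ ((Matrix.det (∑ l, ((X : ℝ[X]) ^ d l) • (S l).map C)).roots.toFinset.filter (fun t => 0 < t)).card) {x : Fin 4} (hx0 : x ≠ 0)
    (ρ : ℕ → ℕ) (hρ' : ∀ n, ρ n = ((Matrix.det (∑ l, ((X : ℝ[X]) ^ d l) • (S l).map C)).support.filter (· < n)).card)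
    (hor : 0 < (-1 : ℝ) ^ ρ (2 * d x + d 0) * ((S 0).adjugate * S 1).trace) : 0 < ((S x).adjugate * S 0).trace := by
  obtain ⟨cxx, mxx⟩ := coeff_square_of_nullNull_seventeen d hd S h0 h3 h17 x 0 hx0
  obtain ⟨c01, m01⟩ := coeff_square_of_nullNull_seventeen d hd S h0 h3 h17 0 1 (by decide)
  have hrank0 := rank_subbottom_of_nullNull_seventeen d hd S h0 h3 h17
  have r0 := coeff_mul_coeff_sign_of_nullNull_seventeen d S h0 h3 h17 m01 mxx
  rw [c01, cxx, hrank0, zero_add, ← hρ'] at r0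
  rcases Nat.mod_two_eq_zero_or_one (ρ (2 * d x + d 0)) with p | p
  · have := r0.1 p
    rw [neg_one_pow_eq_pow_mod_two, p, pow_zero, one_mul] at hor
    nlinarith [this, hor]
  · have := r0.2 p
    rw [neg_one_pow_eq_pow_mod_two, p, pow_one, neg_one_mul, neg_pos] at hor
    nlinarith [this, hor]

/-- **TYPE TEST DI from the bottom end (`S_0 ⪰ 0`) on the null-null sheet**: middle letters `x ≠ y` (`x, y ∈ {1,2}`), `x` hidden-definite, `y` hidden-indefinite
(`c_{0yy} < 0`: parity differs, or `c_{yyy}c_{00y} < 0`), edge count `V_xy ∈ {0,3}`; orientation `0 < (−1)^{ρ(2d_x+d_0)}·c_{001}` ⇒ `Z₊ ≤ 16`. [folklore] -/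
theorem card_posRoots_le_16_of_nullNull_bottomTypeTestDI (d : Fin 4 → ℕ) (hd : StrictMono d) (S : Fin 4 → Matrix (Fin 3) (Fin 3) ℝ)
    (hS : ∀ l, (S l).IsSymm) (h0 : (S 0).det = 0) (h3 : (S 3).det = 0) (hpsd : (S 0).PosSemidef)
    (ρ : ℕ → ℕ) (hρ : ∀ n, ρ n = ((((((Finset.univ : Finset (Sym (Fin 4) 3)).erase (Sym.replicate 3 3)).erase (Sym.replicate 3 0)).image
          (fun s : Sym (Fin 4) 3 => ((s : Multiset (Fin 4)).map d).sum)).filter (· < n)).card))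
    {x y : Fin 4} (hxy : x ≠ y) (hx0 : x ≠ 0) (hx3 : x ≠ 3) (hy0 : y ≠ 0) (hy3 : y ≠ 3)
    (hor : 0 < (-1 : ℝ) ^ ρ (2 * d x + d 0) * ((S 0).adjugate * S 1).trace)
    (hxdef : (ρ (3 * d x) + ρ (2 * d 0 + d x)) % 2 = 0)
    (hyind : ρ (2 * d y + d 0) % 2 ≠ ρ (2 * d x + d 0) % 2 ∨ (ρ (3 * d y) + ρ (2 * d 0 + d y)) % 2 = 1)
    (hV : (ρ (3 * d x) + ρ (2 * d x + d y)) % 2 + (ρ (2 * d x + d y) + ρ (2 * d y + d x)) % 2 + (ρ (2 * d y + d x) + ρ (3 * d y)) % 2 = 0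
      ∨ (ρ (3 * d x) + ρ (2 * d x + d y)) % 2 + (ρ (2 * d x + d y) + ρ (2 * d y + d x)) % 2 + (ρ (2 * d y + d x) + ρ (3 * d y)) % 2 = 3) :
    ((Matrix.det (∑ l, ((X : ℝ[X]) ^ d l) • (S l).map C)).roots.toFinset.filter (fun t => 0 < t)).card ≤ 16 := by
  by_contra hlt
  have h17 : 17 ≤ ((Matrix.det (∑ l, ((X : ℝ[X]) ^ d l) • (S l).map C)).roots.toFinset.filter (fun t => 0 < t)).card := by omega
  have hρ' : ∀ n, ρ n = ((Matrix.det (∑ l, ((X : ℝ[X]) ^ d l) • (S l).map C)).support.filter (· < n)).card := fun n => by rw [hρ, sheetRank_eq_of_nullNull_seventeen d S h0 h3 h17]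
  have hqx := bottom_square_pos_of_orientation_nullNull d hd S h0 h3 h17 hx0 ρ hρ' hor
  obtain ⟨hxd, -⟩ := hiddenDefinite_bottom_of_parity_nullNull d hd S hS h0 h3 hpsd h17 hx0 hx3 ρ hρ' hqx hxdef
  obtain ⟨-, -, HI1y, HI2y⟩ := hiddenType_bottom_of_nullNull_seventeen d hd S hS h0 h3 hpsd h17 hy0
  obtain ⟨cxx, mxx⟩ := coeff_square_of_nullNull_seventeen d hd S h0 h3 h17 x 0 hx0
  obtain ⟨cyy, myy⟩ := coeff_square_of_nullNull_seventeen d hd S h0 h3 h17 y 0 hy0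
  obtain ⟨cTy, mTy⟩ := coeff_square_of_nullNull_seventeen d hd S h0 h3 h17 0 y hy0.symm
  obtain ⟨cy3, my3⟩ := coeff_cube_of_nullNull_seventeen d hd S h0 h3 h17 y hy0 hy3
  have hyn : ¬ (S y).PosDef ∧ ¬ (-S y).PosDef := by
    rcases hyind with hpar | hpar
    · have rxy := (coeff_mul_coeff_sign_of_nullNull_seventeen d S h0 h3 h17 mxx myy).2 (by rw [← hρ', ← hρ']; omega)
      rw [cxx, cyy] at rxy
      exact HI1y (by nlinarith [rxy, hqx])
    · have ry := (coeff_mul_coeff_sign_of_nullNull_seventeen d S h0 h3 h17 my3 mTy).2 (by rw [← hρ', ← hρ']; exact hpar)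
      rw [cy3, cTy] at ry
      exact HI2y ry
  obtain ⟨v1, v2⟩ := definite_indefinite_count_nullNull d hd S hS h0 h3 hxy hx0 hx3 hy0 hy3 hxd hyn.1 hyn.2 h17 ρ hρ'
  rcases hV with hV | hV
  · exact v1 hV
  · exact v2 hV

/-- **TYPE TEST DD from the bottom end (`S_0 ⪰ 0`)**: two hidden-definite middle letters with the wrong edge count. [folklore] -/
theorem card_posRoots_le_16_of_nullNull_bottomTypeTestDD (d : Fin 4 → ℕ) (hd : StrictMono d) (S : Fin 4 → Matrix (Fin 3) (Fin 3) ℝ)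
    (hS : ∀ l, (S l).IsSymm) (h0 : (S 0).det = 0) (h3 : (S 3).det = 0) (hpsd : (S 0).PosSemidef)
    (ρ : ℕ → ℕ) (hρ : ∀ n, ρ n = ((((((Finset.univ : Finset (Sym (Fin 4) 3)).erase (Sym.replicate 3 3)).erase (Sym.replicate 3 0)).image
          (fun s : Sym (Fin 4) 3 => ((s : Multiset (Fin 4)).map d).sum)).filter (· < n)).card))
    {x y : Fin 4} (hxy : x ≠ y) (hx0 : x ≠ 0) (hx3 : x ≠ 3) (hy0 : y ≠ 0) (hy3 : y ≠ 3)
    (hor : 0 < (-1 : ℝ) ^ ρ (2 * d x + d 0) * ((S 0).adjugate * S 1).trace)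
    (hxdef : (ρ (3 * d x) + ρ (2 * d 0 + d x)) % 2 = 0)
    (hysq : ρ (2 * d y + d 0) % 2 = ρ (2 * d x + d 0) % 2) (hydef : (ρ (3 * d y) + ρ (2 * d 0 + d y)) % 2 = 0)
    (hV : ((ρ (2 * d 0 + d x) + ρ (2 * d 0 + d y)) % 2 = 0 ∧
        (ρ (3 * d x) + ρ (2 * d x + d y)) % 2 + (ρ (2 * d x + d y) + ρ (2 * d y + d x)) % 2 + (ρ (2 * d y + d x) + ρ (3 * d y)) % 2 ≠ 0)
      ∨ ((ρ (2 * d 0 + d x) + ρ (2 * d 0 + d y)) % 2 = 1 ∧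
        (ρ (3 * d x) + ρ (2 * d x + d y)) % 2 + (ρ (2 * d x + d y) + ρ (2 * d y + d x)) % 2 + (ρ (2 * d y + d x) + ρ (3 * d y)) % 2 ≠ 3)) :
    ((Matrix.det (∑ l, ((X : ℝ[X]) ^ d l) • (S l).map C)).roots.toFinset.filter (fun t => 0 < t)).card ≤ 16 := by
  by_contra hlt
  have h17 : 17 ≤ ((Matrix.det (∑ l, ((X : ℝ[X]) ^ d l) • (S l).map C)).roots.toFinset.filter (fun t => 0 < t)).card := by omega
  have hρ' : ∀ n, ρ n = ((Matrix.det (∑ l, ((X : ℝ[X]) ^ d l) • (S l).map C)).support.filter (· < n)).card := fun n => by rw [hρ, sheetRank_eq_of_nullNull_seventeen d S h0 h3 h17]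
  have hqx := bottom_square_pos_of_orientation_nullNull d hd S h0 h3 h17 hx0 ρ hρ' hor
  obtain ⟨cxx, mxx⟩ := coeff_square_of_nullNull_seventeen d hd S h0 h3 h17 x 0 hx0
  obtain ⟨cyy, myy⟩ := coeff_square_of_nullNull_seventeen d hd S h0 h3 h17 y 0 hy0
  obtain ⟨cTx, mTx⟩ := coeff_square_of_nullNull_seventeen d hd S h0 h3 h17 0 x hx0.symm
  obtain ⟨cTy, mTy⟩ := coeff_square_of_nullNull_seventeen d hd S h0 h3 h17 0 y hy0.symm
  have rxy := (coeff_mul_coeff_sign_of_nullNull_seventeen d S h0 h3 h17 mxx myy).1 (by rw [← hρ', ← hρ']; omega)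
  rw [cxx, cyy] at rxy
  have hqy : 0 < ((S y).adjugate * S 0).trace := by nlinarith [rxy, hqx]
  obtain ⟨hxd, hxiff⟩ := hiddenDefinite_bottom_of_parity_nullNull d hd S hS h0 h3 hpsd h17 hx0 hx3 ρ hρ' hqx hxdef
  obtain ⟨hyd, hyiff⟩ := hiddenDefinite_bottom_of_parity_nullNull d hd S hS h0 h3 hpsd h17 hy0 hy3 ρ hρ' hqy hydef
  obtain ⟨w0, w3⟩ := definite_pair_count_nullNull d hd S h0 h3 hxy hx0 hx3 hy0 hy3 hxd hyd h17 ρ hρ'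
  have rT := coeff_mul_coeff_sign_of_nullNull_seventeen d S h0 h3 h17 mTx mTy
  rw [cTx, cTy, ← hρ', ← hρ'] at rT
  have hTx := trace_adjugate_mul_ne_zero_of_nullNull_seventeen d hd S h0 h3 h17 0 x hx0.symm
  rcases hV with ⟨hpar, hV⟩ | ⟨hpar, hV⟩
  · have hTT := rT.1 hpar
    refine hV (w0 ?_)
    rw [hxiff, hyiff]
    rcases lt_or_gt_of_ne hTx with hn | hp
    · exact iff_of_false (not_lt.mpr hn.le) (fun h => by nlinarith [hTT, hn, h])
    · exact iff_of_true hp (by nlinarith [hTT, hp])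
  · have hTT := rT.2 hpar
    refine hV (w3 fun hiff => ?_)
    rw [hxiff, hyiff] at hiff
    rcases lt_or_gt_of_ne hTx with hn | hp
    · have hy' : ¬ 0 < ((S 0).adjugate * S y).trace := fun h => absurd (hiff.mpr h) (not_lt.mpr hn.le)
      nlinarith [hTT, hn, not_lt.mp hy']
    · nlinarith [hTT, hp, hiff.mp hp]

end Summit.ValiantsHypothesis.ValiantsHypothesis.Theorems.LacunarySymmetroidMatrixDescartes.Census
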